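import Summits.MatrixMultiplication.MatrixMultiplication.Theorems.AbelianSTPPCensusFP4Defs

/-!
# Rule U11-F4 at `668 = 4·167`: kernel certificate, table `ℤ/2 × ℤ/2`, chunks 1–3 of 3

Cell mm-stpp (rung F-M1), theory lane (seat mm-stpp-theory, gen 17).  Part of the FP4 certificate (`FP4.check`, `AbelianSTPPCensusFP4Defs`) for
the list `(7,7,8)⁴ + (7,7,7)` at `668 = 4·167` (`p = 167`; totals `(P_AB, P_BC, P_CA) = (245, 273, 273)`, letter maxima
`(7,7,8)`, minima `(7,7,7)`, menu `[8,14]`, `2` propagation rounds) for the table `e = 0` (`ℤ/2 × ℤ/2`):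
the bisection tree of this table (1667 nodes; exact Python twin `calc/fp4lean_twin.py`, chunking `calc/twin_frontier.py`) is cut into
3 sub-boxes; this file certifies sub-boxes 1–3 of 3 (1007, 345, 313 nodes) by `decide` with kernel reduction (2 chunk files in all;
`AbelianSTPPCensusFP4Wall668.lean` glues them with `FP4.certify_step`).
WHAT THIS IS NOT: no claim by itself (pieces of one certificate); no census number; no `ω` statement.
-/

set_option linter.dupNamespace false -- `MatrixMultiplication.MatrixMultiplication` (summit = problem, D-0017)
set_option autoImplicit false

namespace Summit.MatrixMultiplication.MatrixMultiplication.Theorems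

namespace FP4Wall668

/-- Certified sub-box `LL` of the FP4 certificate at `M = 668`, table `e = 0` (1007 nodes of the bisection; `decide` with kernel reduction). [bookkeeping] -/
theorem c0_LL : FP4.certify 167 0 245 273 273 7 7 8 7 7 7 [8,14] 2 38
    ⟨⟨0, 0, 0, 0⟩, ⟨83, 167, 167, 167⟩, ⟨0, 0, 0, 0⟩, ⟨83, 167, 167, 167⟩, ⟨0, 0, 0, 0⟩, ⟨167, 167, 167, 167⟩⟩ = true := by
  decide +kernel

/-- Certified sub-box `LR` of the FP4 certificate at `M = 668`, table `e = 0` (345 nodes of the bisection; `decide` with kernel reduction). [bookkeeping] -/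
theorem c0_LR : FP4.certify 167 0 245 273 273 7 7 8 7 7 7 [8,14] 2 38
    ⟨⟨0, 0, 0, 0⟩, ⟨83, 167, 167, 167⟩, ⟨84, 0, 0, 0⟩, ⟨167, 167, 167, 167⟩, ⟨0, 0, 0, 0⟩, ⟨167, 167, 167, 167⟩⟩ = true := by
  decide +kernel

/-- Certified sub-box `R` of the FP4 certificate at `M = 668`, table `e = 0` (313 nodes of the bisection; `decide` with kernel reduction). [bookkeeping] -/
theorem c0_R : FP4.certify 167 0 245 273 273 7 7 8 7 7 7 [8,14] 2 39
    ⟨⟨84, 0, 0, 0⟩, ⟨167, 167, 167, 167⟩, ⟨0, 0, 0, 0⟩, ⟨167, 167, 167, 167⟩, ⟨0, 0, 0, 0⟩, ⟨167, 167, 167, 167⟩⟩ = true := by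
  decide +kernel

end FP4Wall668

end Summit.MatrixMultiplication.MatrixMultiplication.Theorems
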